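import Summits.CriticalPhenomena.PercolationContinuityZ3.Theorems.Transplant.PlanarSkeletonFrmScaledDefs
import HarnessLib

/-!
# Every skeleton interface of the ladder forces minimum degree `≥ 4`: the 3-regular nets need the quasi-step relaxation (Q)

builds on p205010 (kernel theorem, internal audit signed; external expert review pending) — nothing in this file uses p205010; unconditional, no node.
Lane `prim-bschramm`, seat `prim-bschramm-p4` gen 26 (PART C3 of `P4-GENERAL.md` §48).  Helper file (`--supports stmt-CriticalPhenomena-4575 --as helper`).

The scaled interface `PlanarSkeletonFrmScaled` — to which every interface of the skeleton ladder forgets (`PlanarSkeletonFrmFrom.toFrmScaled`, and the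
unit / sign / `{±1}` interfaces through `PlanarSkeletonFrmFrom`) — asks at EVERY vertex for EXACT steps `φ v' = φ v ± N eᵢ` along SINGLE edges.  The four
targets are four distinct chart values, hence four distinct neighbours: **`PlanarSkeletonFrmScaled.four_le_degree`**.  Consequently no 3-regular graph
carries any skeleton of the ladder, with any number of types and any symmetry: the honeycomb lattice (planar, `θ(p_c) = 0` classical), and in three
dimensions the chiral srs net (10,3)-a, ths (10,3)-b and the other 3-coordinated vertex-transitive nets are reachable ONLY through the quasi-step
relaxation (Q) of the planners' end-state node (P4 §41) — a degree count, independent of the grid-covering rigidity of gen 19 (which concerns 4-regular nets).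
[cite: KozmaNitzan2024, §4 p. 16 (Lemma 8)] [cite: BenjaminiSchramm1996, Conj. 4]
-/

noncomputable section

namespace Summit.CriticalPhenomena.PercolationContinuityZ3.Theorems.Transplant

open SimpleGraph Literature.Probability.LatticeModels
open scoped Classical

/-! ### §0. Every skeleton interface forces minimum degree at least four -/

namespace PlanarSkeletonFrmScaled

variable {V : Type} {G : SimpleGraph V} [G.LocallyFinite]

/-- **Minimum degree `≥ 4` is necessary for a `PlanarSkeletonFrmScaled`** (hence for every interface of the ladder, all of which forget to it or
strengthen it): the exact steps `φ v' = φ v ± N eᵢ` along single edges at `v` are four neighbours with four distinct chart values.  So no 3-regular graph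
(honeycomb; srs, ths, …) carries any skeleton of the ladder. [cite: KozmaNitzan2024, §4 p. 16 (Lemma 8)] -/
theorem four_le_degree (Φ : PlanarSkeletonFrmScaled G) (v : V) : 4 ≤ G.degree v := by
  have hN : (Φ.N : ℤ) ≠ 0 := by have := Φ.one_le_N; omega
  let σ : Fin 2 → ℤˣ := fun b => if b = 0 then 1 else -1
  have hσ : ∀ b b' : Fin 2, (σ b : ℤ) = σ b' → b = b' := by
    intro b b' h
    fin_cases b <;> fin_cases b' <;> simp [σ] at h ⊢
  choose f hf using fun p : Fin 2 × Fin 2 => Φ.step v p.1 (σ p.2)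
  have hinj : Function.Injective f := by
    rintro ⟨i, b⟩ ⟨j, b'⟩ hpq
    have h := (hf (i, b)).2
    rw [hpq, (hf (j, b')).2] at h
    have h' : (Pi.single j ((Φ.N : ℤ) * σ b') : Site 2) = Pi.single i ((Φ.N : ℤ) * σ b) := add_left_cancel h
    have hij : i = j := by
      by_contra hne
      have := congrFun h' i
      rw [Pi.single_eq_of_ne hne, Pi.single_eq_same] at this
      exact mul_ne_zero hN (Units.ne_zero (σ b)) this.symm
    subst hij
    have := congrFun h' i
    rw [Pi.single_eq_same, Pi.single_eq_same] at this
    have hb : b = b' := hσ b b' (mul_left_cancel₀ hN this).symm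
    rw [hb]
  have hsub : Finset.univ.image f ⊆ G.neighborFinset v := by
    intro w hw
    obtain ⟨p, -, rfl⟩ := Finset.mem_image.1 hw
    exact (G.mem_neighborFinset v _).2 (hf p).1
  have hcard : (Finset.univ.image f).card = 4 := by
    rw [Finset.card_image_of_injective _ hinj, Finset.card_univ]
    rfl
  rw [← G.card_neighborFinset_eq_degree, ← hcard]
  exact Finset.card_le_card hsub

end PlanarSkeletonFrmScaled

/-- … so a graph with a vertex of degree `≤ 3` carries no `PlanarSkeletonFrmScaled` (3-regular nets: honeycomb, srs, ths). [cite: KozmaNitzan2024, §4 p. 16 (Lemma 8)] -/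
theorem PlanarSkeletonFrmScaled.isEmpty_of_degree_le_three {V : Type} {G : SimpleGraph V} [G.LocallyFinite] (v : V) (hv : G.degree v ≤ 3) :
    IsEmpty (PlanarSkeletonFrmScaled G) :=
  ⟨fun Φ => by have := Φ.four_le_degree v; omega⟩

/-- … nor a `PlanarSkeletonFrmFrom` (unit frames-only interface of the node U), by the forgetful map. [cite: KozmaNitzan2024, §4 p. 16 (Lemma 8)] -/
theorem PlanarSkeletonFrmFrom.isEmpty_of_degree_le_three {V : Type} {G : SimpleGraph V} [G.LocallyFinite] (v : V) (hv : G.degree v ≤ 3) :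
    IsEmpty (PlanarSkeletonFrmFrom G) :=
  ⟨fun Φ => (PlanarSkeletonFrmScaled.isEmpty_of_degree_le_three v hv).false Φ.toFrmScaled⟩

end Summit.CriticalPhenomena.PercolationContinuityZ3.Theorems.Transplant

end
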